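import Summits.Langlands.Langlands.Theses.CyclicLayerPeeling
import Literature.NumberTheory.Automorphic.ReciprocityGLnRestrictionProofs
import Literature.NumberTheory.Automorphic.BaseChangeGLnProofs
import Literature.NumberTheory.GaloisRepresentations.RestrictFieldSemisimple
import Summits.Langlands.Langlands.Theses.GaloisHullLift

/-! BC3 birth skeleton for `SelfTwistedHullDescent` (node `GaloisHullLift`, lens-4 g24; r1 IH-TYPED statement — the rank induction hypothesis «Galois-hull descent at every rank m < n»
is a binder of the crux and is threaded through both stubs unchanged).  PRE-BIRTH form (text verbatim below); after birth swap the def for the route decl `Summit.Langlands.Langlands.Theses.GaloisHullLift.SelfTwistedHullDescent` and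
publish as `Cruxes/SelfTwistedHullDescent/Lines/birth.lean`.  Two registered stubs by the degrees of the self-twisting bottom layers: `stub_coprimeDegree` (some cyclic-prime bottom
layer F has [F:K] ∤ n — VACUOUS for the right reason: F is a.e.-Satake self-twisted by the guard, and at a.e. inert v the Satake multiset of π_v has n non-zero entries,
which cannot be stable under multiplication by a primitive p-th root of unity unless p ∣ n; needs: Satake multisets have cardinality n with non-zero entries and
infinitely many places of K are inert in F (Chebotarev for F/K cyclic) — size M; this is the BC5 PLAN-ONLY rung) and `stub_dividingDegree` (every bottom layer has
degree dividing n, hardest: π = AI_(F/K)(τ) by Arthur–Clozel III.4.2(b)/6.3/6.5; the relative avatar r of π along L/K is a relative avatar of the isobaric τ ⊞ τ^σ ⊞ ⋯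
along L/F and must be UNMIXED into relative avatars of the τ^(σ^i) (rank n/p) — the one open step — then descended BY THE RANK-IH binder along the Galois layer L/F and re-induced
(host `InductionTransport` 29151)).  The composition is excluded middle on «every cyclic-prime bottom layer has degree ∣ n». -/

set_option linter.dupNamespace false
set_option linter.unusedVariables false

open scoped BigOperators Topology Manifold Classical MeasureTheory ProbabilityTheory Matrix InnerProductSpace ComplexConjugate ContinuousMap
open Filter Set Function TopologicalSpace MeasureTheory

namespace Summit.Langlands.Langlands.Cruxes.SelfTwistedHullDescent.Birth

-- POST-BIRTH form: the local restated `def SelfTwistedHullDescent` of the pre-birth kit is removed; stubs unchanged; ONE closed theorem `SelfTwistedHullDescent_proof` concludes the ROUTE DECL by name.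

/-- stub S1 · COPRIME DEGREE (vacuous for the right reason: an a.e.-Satake self-twist along F forces [F:K] ∣ n). BC5 plan-only rung. -/
theorem stub_coprimeDegree :
    ∀ (K : Type) [Field K] [NumberField K] (n : ℕ) (hcpt : Literature.NumberTheory.Automorphic.isCompact_glFiniteIntegralLevel n K), 0 < n → (∀ (m : ℕ), m < n → ∀ (K' : Type) [Field K'] [NumberField K'] (hcpt' : Literature.NumberTheory.Automorphic.isCompact_glFiniteIntegralLevel m K'), 0 < m → ∀ (π' : Literature.NumberTheory.Automorphic.CuspidalAutomorphicRepData m K' hcpt'), π'.1.IsLAlgebraic → ∀ (L' : Type) [Field L'] [NumberField L'] [Algebra K' L'], IsGalois K' L' → ∀ (ℓ : ℕ) [Fact ℓ.Prime] (ι : PadicAlgCl ℓ ≃+* ℂ) (r : Literature.NumberTheory.GaloisRepresentations.FramedGaloisRep L' (PadicAlgCl ℓ) m), r.toGaloisRep.IsSemisimple → (∀ᶠ w : IsDedekindDomain.HeightOneSpectrum (NumberField.RingOfIntegers L') in cofinite, ∀ (v : IsDedekindDomain.HeightOneSpectrum (NumberField.RingOfIntegers K')) (α : Multiset ℂ), w.asIdeal.under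 (NumberField.RingOfIntegers K') = v.asIdeal → π'.1.HasSatakeParamAt v α → r.IsUnramifiedAt w ∧ r.HasFrobCharpolyAt w (Literature.NumberTheory.Automorphic.arithFrobPolyOfSatake ι w.residueCard 1 (α.map (fun a => a ^ w.asIdeal.inertiaDeg (NumberField.RingOfIntegers K'))))) → ∃ ρ : Literature.NumberTheory.GaloisRepresentations.FramedGaloisRep K' (PadicAlgCl ℓ) m, ρ.toGaloisRep.IsSemisimple ∧ ∀ᶠ v : IsDedekindDomain.HeightOneSpectrum (NumberField.RingOfIntegers K') in cofinite, SatakeFrobCompatibleAt ι π'.1 ρ v) → ∀ (π : Literature.NumberTheory.Automorphic.CuspidalAutomorphicRepData n K hcpt), π.1.IsLAlgebraic → ∀ (L : Type) [Field L] [NumberField L] [Algebra K L], IsGalois K L → (∃ F : IntermediateField K L, (F ≠ ⊥ ∧ IsGalois K ↥F ∧ IsCyclic (↥F ≃ₐ[K] ↥F) ∧ (Module.finrank K ↥F).Prime) ∧ ¬ (Module.finrank K ↥F ∣ n)) → (∀ F : IntermediateField K L, F ≠ ⊥ → IsGalois K ↥F → IsCyclic (↥F ≃ₐ[K] ↥F)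 → (Module.finrank K ↥F).Prime → (∀ᶠ v : IsDedekindDomain.HeightOneSpectrum (NumberField.RingOfIntegers K) in cofinite, (∀ w : IsDedekindDomain.HeightOneSpectrum (NumberField.RingOfIntegers ↥F), w.asIdeal.under (NumberField.RingOfIntegers K) = v.asIdeal → w.asIdeal.inertiaDeg (NumberField.RingOfIntegers K) ≠ 1) → ∀ α : Multiset ℂ, π.1.HasSatakeParamAt v α → α.map (fun z => Complex.exp (2 * Real.pi * Complex.I / (Module.finrank K ↥F : ℂ)) * z) = α)) → ∀ (ℓ : ℕ) [Fact ℓ.Prime] (ι : PadicAlgCl ℓ ≃+* ℂ) (r : Literature.NumberTheory.GaloisRepresentations.FramedGaloisRep L (PadicAlgCl ℓ) n), r.toGaloisRep.IsSemisimple → (∀ᶠ w : IsDedekindDomain.HeightOneSpectrum (NumberField.RingOfIntegers L) in cofinite, ∀ (v : IsDedekindDomain.HeightOneSpectrum (NumberField.RingOfIntegers K)) (α : Multiset ℂ), w.asIdeal.under (NumberField.RingOfIntegers K) = v.asIdeal → π.1.HasSatakeParamAt v α → r.IsUnramifiedAt w ∧ r.HasFrobCharpolyAt w (Literature.NumberTheory.Automorphic.arithFrobPolyOfSatake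 ι w.residueCard 1 (α.map (fun a => a ^ w.asIdeal.inertiaDeg (NumberField.RingOfIntegers K))))) → ∃ ρ : Literature.NumberTheory.GaloisRepresentations.FramedGaloisRep K (PadicAlgCl ℓ) n, ρ.toGaloisRep.IsSemisimple ∧ ∀ᶠ v : IsDedekindDomain.HeightOneSpectrum (NumberField.RingOfIntegers K) in cofinite, SatakeFrobCompatibleAt ι π.1 ρ v := by
  sorry

/-- stub S2 · ALL DEGREES DIVIDE n (hardest): π automorphically induced; unmix, descend in rank n/p, re-induce. -/
theorem stub_dividingDegree :
    ∀ (K : Type) [Field K] [NumberField K] (n : ℕ) (hcpt : Literature.NumberTheory.Automorphic.isCompact_glFiniteIntegralLevel n K), 0 < n → (∀ (m : ℕ), m < n → ∀ (K' : Type) [Field K'] [NumberField K'] (hcpt' : Literature.NumberTheory.Automorphic.isCompact_glFiniteIntegralLevel m K'), 0 < m → ∀ (π' : Literature.NumberTheory.Automorphic.CuspidalAutomorphicRepData m K' hcpt'), π'.1.IsLAlgebraic → ∀ (L' : Type) [Field L'] [NumberField L'] [Algebra K' L'], IsGalois K' L' → ∀ (ℓ : ℕ) [Fact ℓ.Prime]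 (ι : PadicAlgCl ℓ ≃+* ℂ) (r : Literature.NumberTheory.GaloisRepresentations.FramedGaloisRep L' (PadicAlgCl ℓ) m), r.toGaloisRep.IsSemisimple → (∀ᶠ w : IsDedekindDomain.HeightOneSpectrum (NumberField.RingOfIntegers L') in cofinite, ∀ (v : IsDedekindDomain.HeightOneSpectrum (NumberField.RingOfIntegers K')) (α : Multiset ℂ), w.asIdeal.under (NumberField.RingOfIntegers K') = v.asIdeal → π'.1.HasSatakeParamAt v α → r.IsUnramifiedAt w ∧ r.HasFrobCharpolyAt w (Literature.NumberTheory.Automorphic.arithFrobPolyOfSatake ι w.residueCard 1 (α.map (fun a => a ^ w.asIdeal.inertiaDeg (NumberField.RingOfIntegers K'))))) → ∃ ρ : Literature.NumberTheory.GaloisRepresentations.FramedGaloisRep K' (PadicAlgCl ℓ) m, ρ.toGaloisRep.IsSemisimple ∧ ∀ᶠ v : IsDedekindDomain.HeightOneSpectrum (NumberField.RingOfIntegers K') in cofinite, SatakeFrobCompatibleAt ι π'.1 ρ v) → ∀ (π : Literature.NumberTheory.Automorphic.CuspidalAutomorphicRepData n K hcpt), π.1.IsLAlgebraic → ∀ (L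 : Type) [Field L] [NumberField L] [Algebra K L], IsGalois K L → (∃ F : IntermediateField K L, F ≠ ⊥ ∧ IsGalois K ↥F ∧ IsCyclic (↥F ≃ₐ[K] ↥F) ∧ (Module.finrank K ↥F).Prime) → (∀ F : IntermediateField K L, F ≠ ⊥ → IsGalois K ↥F → IsCyclic (↥F ≃ₐ[K] ↥F) → (Module.finrank K ↥F).Prime → (∀ᶠ v : IsDedekindDomain.HeightOneSpectrum (NumberField.RingOfIntegers K) in cofinite, (∀ w : IsDedekindDomain.HeightOneSpectrum (NumberField.RingOfIntegers ↥F), w.asIdeal.under (NumberField.RingOfIntegers K) = v.asIdeal → w.asIdeal.inertiaDeg (NumberField.RingOfIntegers K) ≠ 1) → ∀ α : Multiset ℂ, π.1.HasSatakeParamAt v α → α.map (fun z => Complex.exp (2 * Real.pi * Complex.I / (Module.finrank K ↥F : ℂ)) * z) = α)) → (∀ F : IntermediateField K L, F ≠ ⊥ → IsGalois K ↥F → IsCyclic (↥F ≃ₐ[K] ↥F) → (Module.finrank K ↥F).Prime → Module.finrank K ↥F ∣ n) → ∀ (ℓ : ℕ) [Fact ℓ.Prime] (ι : PadicAlgCl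 ℓ ≃+* ℂ) (r : Literature.NumberTheory.GaloisRepresentations.FramedGaloisRep L (PadicAlgCl ℓ) n), r.toGaloisRep.IsSemisimple → (∀ᶠ w : IsDedekindDomain.HeightOneSpectrum (NumberField.RingOfIntegers L) in cofinite, ∀ (v : IsDedekindDomain.HeightOneSpectrum (NumberField.RingOfIntegers K)) (α : Multiset ℂ), w.asIdeal.under (NumberField.RingOfIntegers K) = v.asIdeal → π.1.HasSatakeParamAt v α → r.IsUnramifiedAt w ∧ r.HasFrobCharpolyAt w (Literature.NumberTheory.Automorphic.arithFrobPolyOfSatake ι w.residueCard 1 (α.map (fun a => a ^ w.asIdeal.inertiaDeg (NumberField.RingOfIntegers K))))) → ∃ ρ : Literature.NumberTheory.GaloisRepresentations.FramedGaloisRep K (PadicAlgCl ℓ) n, ρ.toGaloisRep.IsSemisimple ∧ ∀ᶠ v : IsDedekindDomain.HeightOneSpectrum (NumberField.RingOfIntegers K) in cofinite, SatakeFrobCompatibleAt ι π.1 ρ v := by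
  sorry

/-- CLOSED COMPOSITION (post-birth shape, writer-1 WORD (A)(61)): the route decl `Summit.Langlands.Langlands.Theses.GaloisHullLift.SelfTwistedHullDescent` from the registered stubs. -/
theorem SelfTwistedHullDescent_proof :
    Summit.Langlands.Langlands.Theses.GaloisHullLift.SelfTwistedHullDescent := by
  have h1 := stub_coprimeDegree
  have h2 := stub_dividingDegree
  intro K _ _ n hcpt hn hIH π hπ L _ _ _ hGal hex hall ℓ _ ι r hr hrel
  by_cases hdiv : (∀ F : IntermediateField K L, F ≠ ⊥ → IsGalois K ↥F → IsCyclic (↥F ≃ₐ[K] ↥F) → (Module.finrank K ↥F).Prime → Module.finrank K ↥F ∣ n)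
  · exact h2 K n hcpt hn hIH π hπ L hGal hex hall hdiv ℓ ι r hr hrel
  · simp only [not_forall] at hdiv
    obtain ⟨F, hbot, hGalF, hcycF, hpF, hnd⟩ := hdiv
    exact h1 K n hcpt hn hIH π hπ L hGal ⟨F, ⟨hbot, hGalF, hcycF, hpF⟩, hnd⟩ hall ℓ ι r hr hrel

end Summit.Langlands.Langlands.Cruxes.SelfTwistedHullDescent.Birth
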